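import Summits.CriticalPhenomena.PercolationContinuityZ3.Theorems.Transplant.FKConnectivityAllQAntipodalMinorGluing
import HarnessLib

/-!
# Connectivity correlation inequalities for `φ_{w,q}`, every `q > 0` — file 22b: the antipodal exponent of a THETA of THREE two-terminal
# networks (the bridge identity of the three-box normal form of `maj₃`)

Support file (`--supports stmt-CriticalPhenomena-4575`), FK sub-lane `prim-bschramm-fk-2` (gen 24); builds on p205010 (kernel theorem,
internal audit signed; external expert review pending).  No definitions, no named facts, no sorries; standard axioms.

`…AntipodalMinorGluing.lean` (gen 11) computed the antipodal cluster exponent `apExpC` of the PARALLEL composition of two networks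
between `s, t` from the parts: `+ 2|V|` on the left, `+ 1{both parts join s,t in replica 1} + 1{both in replica 2}` on the right
(`FK.apExpC_parallel`), together with the connection rule `s ↔ t in the composite ↔ in one of the parts` (`FK.reachable_union_parallel`).
This file iterates both once: for THREE networks `E₁, E₂, E₃` between `s, t`, pairwise edge-disjoint and meeting pairwise only inside
`{s, t}` — the theta host `Θ(B_x, B_y, B_z)` of the level-3 antipodal inequality (FK-Q2 §32–§33) —
* `FK.reachable_union_parallel3`: `s ↔ t` in `γ₁ ∪ γ₂ ∪ γ₃` iff in some `γᵢ`;
* `FK.apExpC_parallel3`: `apExpC (M₁∪M₂∪M₃) (C₁∪C₂∪C₃) (γ₁∪γ₂∪γ₃) + 4|V| = Σᵢ apExpC Mᵢ Cᵢ γᵢ + J(c₁,c₂,c₃) + J(c̄₁,c̄₂,c̄₃)` with the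
  JUNCTION TERM `J(a,b,c) = 1{a ∧ b} + 1{(a ∨ b) ∧ c} = (#{i : part i joins s,t} − 1)⁺` in each replica (`cᵢ` / `c̄ᵢ` = the part `γᵢ ∪ Cᵢ` /
  `(Mᵢ \ γᵢ) ∪ Cᵢ` joins `s, t`).
So the level of the theta is additive in the boxes up to the junction term `(n−1)⁺ + (n̄−1)⁺` — the one coupling between the three boxes, and
the source of the whole difficulty of `maj₃` beyond separating junctions (memo FROM-fk-2-g24-BLACKBOX.md §1, §4.5).
[cite: Grimmett2006, §1.4 eq. (1.20) (p. 15); §3.8 (pp. 61–62)]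
-/

noncomputable section

namespace Summit.CriticalPhenomena.PercolationContinuityZ3.Theorems

namespace FK

open SimpleGraph Literature.Probability.LatticeModels Literature.Probability.Percolation
open scoped Classical

variable {V : Type*} [Fintype V]

section Parallel3

variable {E₁ E₂ E₃ : Finset (Sym2 V)} {V₁ V₂ V₃ : Set V} {s t : V}

omit [Fintype V] in
/-- Edges of `E₁ ∪ E₂` lie inside `V₁ ∪ V₂`. [folklore] -/
theorem edges_union_subset_verts (h₁ : ∀ e ∈ (↑E₁ : Set (Sym2 V)), ∀ z ∈ e, z ∈ V₁)
    (h₂ : ∀ e ∈ (↑E₂ : Set (Sym2 V)), ∀ z ∈ e, z ∈ V₂) :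
    ∀ e ∈ (↑(E₁ ∪ E₂) : Set (Sym2 V)), ∀ z ∈ e, z ∈ V₁ ∪ V₂ := by
  intro e he z hz
  rw [Finset.coe_union, Set.mem_union] at he
  rcases he with he | he
  · exact Or.inl (h₁ e he z hz)
  · exact Or.inr (h₂ e he z hz)

omit [Fintype V] in
/-- The union of two parts meets a third part inside `{s, t}` when each does. [folklore] -/
theorem union_inter_subset_pair (h₁₃ : V₁ ∩ V₃ ⊆ {s, t}) (h₂₃ : V₂ ∩ V₃ ⊆ {s, t}) : (V₁ ∪ V₂) ∩ V₃ ⊆ {s, t} := by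
  intro z hz
  rcases hz.1 with h | h
  · exact h₁₃ ⟨h, hz.2⟩
  · exact h₂₃ ⟨h, hz.2⟩

omit [Fintype V] in
/-- **Connection rule for a theta of three networks**: if `E₁, E₂, E₃` (between `s, t`) pairwise meet only inside `{s, t}`, then for
sub-configurations `γᵢ ⊆ Eᵢ`, `s ↔ t` in `γ₁ ∪ γ₂ ∪ γ₃` iff `s ↔ t` in some `γᵢ`. [folklore] -/
theorem reachable_union_parallel3 (h₁ : ∀ e ∈ (↑E₁ : Set (Sym2 V)), ∀ z ∈ e, z ∈ V₁)
    (h₂ : ∀ e ∈ (↑E₂ : Set (Sym2 V)), ∀ z ∈ e, z ∈ V₂) (h₃ : ∀ e ∈ (↑E₃ : Set (Sym2 V)), ∀ z ∈ e, z ∈ V₃)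
    (h₁₂ : V₁ ∩ V₂ ⊆ {s, t}) (h₁₃ : V₁ ∩ V₃ ⊆ {s, t}) (h₂₃ : V₂ ∩ V₃ ⊆ {s, t})
    {γ₁ γ₂ γ₃ : Finset (Sym2 V)} (hγ₁ : γ₁ ⊆ E₁) (hγ₂ : γ₂ ⊆ E₂) (hγ₃ : γ₃ ⊆ E₃) :
    (openGraph (↑(γ₁ ∪ γ₂ ∪ γ₃) : BondConfig V)).Reachable s t ↔
      (openGraph (↑γ₁ : BondConfig V)).Reachable s t ∨ (openGraph (↑γ₂ : BondConfig V)).Reachable s t ∨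
        (openGraph (↑γ₃ : BondConfig V)).Reachable s t := by
  rw [reachable_union_parallel (edges_union_subset_verts h₁ h₂) h₃ (union_inter_subset_pair h₁₃ h₂₃)
    (Finset.union_subset_union hγ₁ hγ₂) hγ₃, reachable_union_parallel h₁ h₂ h₁₂ hγ₁ hγ₂, or_assoc]

/-- **THE THETA BRIDGE (antipodal exponent of three networks in parallel).**  If `E₁, E₂, E₃` are pairwise edge-disjoint networks
between `s ≠ t` whose vertex sets pairwise meet only inside `{s, t}`, then for free sets `Mᵢ ⊆ Eᵢ`, contracted sets `Cᵢ ⊆ Eᵢ` and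
configurations `γᵢ ⊆ Mᵢ`, writing `cᵢ = 1{s ↔ t in γᵢ ∪ Cᵢ}`, `c̄ᵢ = 1{s ↔ t in (Mᵢ \ γᵢ) ∪ Cᵢ}`:
`apExpC (M₁∪M₂∪M₃) (C₁∪C₂∪C₃) (γ₁∪γ₂∪γ₃) + 4|V| = Σᵢ apExpC Mᵢ Cᵢ γᵢ + [c₁∧c₂] + [(c₁∨c₂)∧c₃] + [c̄₁∧c̄₂] + [(c̄₁∨c̄₂)∧c̄₃]` —
the level of the theta is the sum of the box levels plus `(n−1)⁺ + (n̄−1)⁺`, `n, n̄` the numbers of boxes joining the poles in the two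
replicas. [cite: Grimmett2006, §1.4 eq. (1.20) (p. 15); §3.8 (pp. 61–62)] -/
theorem apExpC_parallel3 (hd₁₂ : Disjoint E₁ E₂) (hd₁₃ : Disjoint E₁ E₃) (hd₂₃ : Disjoint E₂ E₃)
    (h₁ : ∀ e ∈ (↑E₁ : Set (Sym2 V)), ∀ z ∈ e, z ∈ V₁) (h₂ : ∀ e ∈ (↑E₂ : Set (Sym2 V)), ∀ z ∈ e, z ∈ V₂)
    (h₃ : ∀ e ∈ (↑E₃ : Set (Sym2 V)), ∀ z ∈ e, z ∈ V₃)
    (h₁₂ : V₁ ∩ V₂ ⊆ {s, t}) (h₁₃ : V₁ ∩ V₃ ⊆ {s, t}) (h₂₃ : V₂ ∩ V₃ ⊆ {s, t}) (hst : s ≠ t)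
    {M₁ M₂ M₃ C₁ C₂ C₃ γ₁ γ₂ γ₃ : Finset (Sym2 V)} (hM₁ : M₁ ⊆ E₁) (hM₂ : M₂ ⊆ E₂) (hM₃ : M₃ ⊆ E₃)
    (hC₁ : C₁ ⊆ E₁) (hC₂ : C₂ ⊆ E₂) (hC₃ : C₃ ⊆ E₃) (hγ₁ : γ₁ ⊆ M₁) (hγ₂ : γ₂ ⊆ M₂) (hγ₃ : γ₃ ⊆ M₃) :
    apExpC (M₁ ∪ M₂ ∪ M₃) (C₁ ∪ C₂ ∪ C₃) (γ₁ ∪ γ₂ ∪ γ₃) + 4 * Fintype.card V =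
      apExpC M₁ C₁ γ₁ + apExpC M₂ C₂ γ₂ + apExpC M₃ C₃ γ₃ +
        ((if (openGraph (↑(γ₁ ∪ C₁) : BondConfig V)).Reachable s t ∧ (openGraph (↑(γ₂ ∪ C₂) : BondConfig V)).Reachable s t
            then 1 else 0) +
          (if ((openGraph (↑(γ₁ ∪ C₁) : BondConfig V)).Reachable s t ∨ (openGraph (↑(γ₂ ∪ C₂) : BondConfig V)).Reachable s t) ∧
              (openGraph (↑(γ₃ ∪ C₃) : BondConfig V)).Reachable s t then 1 else 0)) +
        ((if (openGraph (↑(M₁ \ γ₁ ∪ C₁) : BondConfig V)).Reachable s t ∧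
              (openGraph (↑(M₂ \ γ₂ ∪ C₂) : BondConfig V)).Reachable s t then 1 else 0) +
          (if ((openGraph (↑(M₁ \ γ₁ ∪ C₁) : BondConfig V)).Reachable s t ∨
                (openGraph (↑(M₂ \ γ₂ ∪ C₂) : BondConfig V)).Reachable s t) ∧
              (openGraph (↑(M₃ \ γ₃ ∪ C₃) : BondConfig V)).Reachable s t then 1 else 0)) := by
  -- the pair (1,2)
  have k12 := apExpC_parallel hd₁₂ h₁ h₂ h₁₂ hst hM₁ hM₂ hC₁ hC₂ hγ₁ hγ₂
  -- the pair ((1,2),3)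
  have hd : Disjoint (E₁ ∪ E₂) E₃ := Finset.disjoint_union_left.2 ⟨hd₁₃, hd₂₃⟩
  have k := apExpC_parallel hd (edges_union_subset_verts h₁ h₂) h₃ (union_inter_subset_pair h₁₃ h₂₃) hst
    (Finset.union_subset_union hM₁ hM₂) hM₃ (Finset.union_subset_union hC₁ hC₂) hC₃
    (Finset.union_subset_union hγ₁ hγ₂) hγ₃
  -- the connection bits of the pair (1,2)
  have hdM : Disjoint M₁ M₂ := Finset.disjoint_of_subset_left hM₁ (Finset.disjoint_of_subset_right hM₂ hd₁₂)
  have hc : (openGraph (↑(γ₁ ∪ γ₂ ∪ (C₁ ∪ C₂)) : BondConfig V)).Reachable s t ↔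
      (openGraph (↑(γ₁ ∪ C₁) : BondConfig V)).Reachable s t ∨ (openGraph (↑(γ₂ ∪ C₂) : BondConfig V)).Reachable s t := by
    rw [union_union_glue]
    exact reachable_union_parallel h₁ h₂ h₁₂ (Finset.union_subset (hγ₁.trans hM₁) hC₁)
      (Finset.union_subset (hγ₂.trans hM₂) hC₂)
  have hcb : (openGraph (↑((M₁ ∪ M₂) \ (γ₁ ∪ γ₂) ∪ (C₁ ∪ C₂)) : BondConfig V)).Reachable s t ↔
      (openGraph (↑(M₁ \ γ₁ ∪ C₁) : BondConfig V)).Reachable s t ∨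
        (openGraph (↑(M₂ \ γ₂ ∪ C₂) : BondConfig V)).Reachable s t := by
    rw [union_sdiff_union hdM hγ₁ hγ₂, union_union_glue]
    exact reachable_union_parallel h₁ h₂ h₁₂ (Finset.union_subset (Finset.sdiff_subset.trans hM₁) hC₁)
      (Finset.union_subset (Finset.sdiff_subset.trans hM₂) hC₂)
  simp only [hc, hcb] at k
  omega

/-- **The theta as a triple sum (regrouping by boxes).**  Under the hypotheses of `apExpC_parallel3`, a sum over the configurations of the
theta of any quantity depending on the antipodal exponent (shifted by `4|V|`) and on the configuration is the triple sum over the boxes'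
configurations with the exponent replaced by `Σᵢ apExpC Mᵢ Cᵢ γᵢ +` the two junction terms — the form in which the three-box normal form
of `maj₃` is analysed box by box (FK-Q2 §33). [cite: Grimmett2006, §1.4 eq. (1.20) (p. 15); §3.8 (pp. 61–62)] -/
theorem sum_powerset_theta3 (hd₁₂ : Disjoint E₁ E₂) (hd₁₃ : Disjoint E₁ E₃) (hd₂₃ : Disjoint E₂ E₃)
    (h₁ : ∀ e ∈ (↑E₁ : Set (Sym2 V)), ∀ z ∈ e, z ∈ V₁) (h₂ : ∀ e ∈ (↑E₂ : Set (Sym2 V)), ∀ z ∈ e, z ∈ V₂)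
    (h₃ : ∀ e ∈ (↑E₃ : Set (Sym2 V)), ∀ z ∈ e, z ∈ V₃)
    (h₁₂ : V₁ ∩ V₂ ⊆ {s, t}) (h₁₃ : V₁ ∩ V₃ ⊆ {s, t}) (h₂₃ : V₂ ∩ V₃ ⊆ {s, t}) (hst : s ≠ t)
    {M₁ M₂ M₃ C₁ C₂ C₃ : Finset (Sym2 V)} (hM₁ : M₁ ⊆ E₁) (hM₂ : M₂ ⊆ E₂) (hM₃ : M₃ ⊆ E₃)
    (hC₁ : C₁ ⊆ E₁) (hC₂ : C₂ ⊆ E₂) (hC₃ : C₃ ⊆ E₃) (Φ : ℕ → Finset (Sym2 V) → ℝ) :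
    ∑ γ ∈ (M₁ ∪ M₂ ∪ M₃).powerset, Φ (apExpC (M₁ ∪ M₂ ∪ M₃) (C₁ ∪ C₂ ∪ C₃) γ + 4 * Fintype.card V) γ =
      ∑ γ₁ ∈ M₁.powerset, ∑ γ₂ ∈ M₂.powerset, ∑ γ₃ ∈ M₃.powerset,
        Φ (apExpC M₁ C₁ γ₁ + apExpC M₂ C₂ γ₂ + apExpC M₃ C₃ γ₃ +
            ((if (openGraph (↑(γ₁ ∪ C₁) : BondConfig V)).Reachable s t ∧ (openGraph (↑(γ₂ ∪ C₂) : BondConfig V)).Reachable s t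
                then 1 else 0) +
              (if ((openGraph (↑(γ₁ ∪ C₁) : BondConfig V)).Reachable s t ∨
                    (openGraph (↑(γ₂ ∪ C₂) : BondConfig V)).Reachable s t) ∧
                  (openGraph (↑(γ₃ ∪ C₃) : BondConfig V)).Reachable s t then 1 else 0)) +
            ((if (openGraph (↑(M₁ \ γ₁ ∪ C₁) : BondConfig V)).Reachable s t ∧
                  (openGraph (↑(M₂ \ γ₂ ∪ C₂) : BondConfig V)).Reachable s t then 1 else 0) +
              (if ((openGraph (↑(M₁ \ γ₁ ∪ C₁) : BondConfig V)).Reachable s t ∨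
                    (openGraph (↑(M₂ \ γ₂ ∪ C₂) : BondConfig V)).Reachable s t) ∧
                  (openGraph (↑(M₃ \ γ₃ ∪ C₃) : BondConfig V)).Reachable s t then 1 else 0)))
          (γ₁ ∪ γ₂ ∪ γ₃) := by
  have hd12M : Disjoint M₁ M₂ := Finset.disjoint_of_subset_left hM₁ (Finset.disjoint_of_subset_right hM₂ hd₁₂)
  have hd3M : Disjoint (M₁ ∪ M₂) M₃ :=
    Finset.disjoint_union_left.2 ⟨Finset.disjoint_of_subset_left hM₁ (Finset.disjoint_of_subset_right hM₃ hd₁₃),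
      Finset.disjoint_of_subset_left hM₂ (Finset.disjoint_of_subset_right hM₃ hd₂₃)⟩
  rw [sum_powerset_union_disj hd3M]
  rw [sum_powerset_union_disj hd12M]
  refine Finset.sum_congr rfl fun γ₁ hγ₁ => Finset.sum_congr rfl fun γ₂ hγ₂ => Finset.sum_congr rfl fun γ₃ hγ₃ => ?_
  rw [Finset.mem_powerset] at hγ₁ hγ₂ hγ₃
  rw [apExpC_parallel3 hd₁₂ hd₁₃ hd₂₃ h₁ h₂ h₃ h₁₂ h₁₃ h₂₃ hst hM₁ hM₂ hM₃ hC₁ hC₂ hC₃ hγ₁ hγ₂ hγ₃]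

/-- **The weighted antipodal form of a theta, box by box.**  For any pattern function `f` and test function `g` and any weight `w`, the
weighted antipodal form `Σ_γ w(apExpC M C γ)·(f(γ∪C) − f((M\γ)∪C))·(g(γ∪C) − g((M\γ)∪C))` of the theta `M = M₁ ∪ M₂ ∪ M₃`, `C = C₁ ∪ C₂ ∪ C₃`
is the triple sum over the boxes' configurations in which the two replicas are `γ₁∪γ₂∪γ₃ ∪ C` and `(M₁\γ₁)∪(M₂\γ₂)∪(M₃\γ₃) ∪ C` and the weight
is read at `Σᵢ apExpC Mᵢ Cᵢ γᵢ + J(c) + J(c̄) − 4|V|` (the shifted weight `n ↦ w(n − 4|V|)`).  This is the entry point of the box-by-box analysis of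
`maj₃` on a theta (f = the majority indicator of the three special edges; FK-Q2 §33). [cite: Grimmett2006, §1.4 eq. (1.20) (p. 15); §3.8 (pp. 61–62)] -/
theorem apPsiCW_theta3_eq (hd₁₂ : Disjoint E₁ E₂) (hd₁₃ : Disjoint E₁ E₃) (hd₂₃ : Disjoint E₂ E₃)
    (h₁ : ∀ e ∈ (↑E₁ : Set (Sym2 V)), ∀ z ∈ e, z ∈ V₁) (h₂ : ∀ e ∈ (↑E₂ : Set (Sym2 V)), ∀ z ∈ e, z ∈ V₂)
    (h₃ : ∀ e ∈ (↑E₃ : Set (Sym2 V)), ∀ z ∈ e, z ∈ V₃)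
    (h₁₂ : V₁ ∩ V₂ ⊆ {s, t}) (h₁₃ : V₁ ∩ V₃ ⊆ {s, t}) (h₂₃ : V₂ ∩ V₃ ⊆ {s, t}) (hst : s ≠ t)
    {M₁ M₂ M₃ C₁ C₂ C₃ : Finset (Sym2 V)} (hM₁ : M₁ ⊆ E₁) (hM₂ : M₂ ⊆ E₂) (hM₃ : M₃ ⊆ E₃)
    (hC₁ : C₁ ⊆ E₁) (hC₂ : C₂ ⊆ E₂) (hC₃ : C₃ ⊆ E₃) (w : ℕ → ℝ) (f g : Finset (Sym2 V) → ℝ) :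
    ∑ γ ∈ (M₁ ∪ M₂ ∪ M₃).powerset, w (apExpC (M₁ ∪ M₂ ∪ M₃) (C₁ ∪ C₂ ∪ C₃) γ) *
        ((f (γ ∪ (C₁ ∪ C₂ ∪ C₃)) - f ((M₁ ∪ M₂ ∪ M₃) \ γ ∪ (C₁ ∪ C₂ ∪ C₃))) *
          (g (γ ∪ (C₁ ∪ C₂ ∪ C₃)) - g ((M₁ ∪ M₂ ∪ M₃) \ γ ∪ (C₁ ∪ C₂ ∪ C₃)))) =
      ∑ γ₁ ∈ M₁.powerset, ∑ γ₂ ∈ M₂.powerset, ∑ γ₃ ∈ M₃.powerset,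
        w (apExpC M₁ C₁ γ₁ + apExpC M₂ C₂ γ₂ + apExpC M₃ C₃ γ₃ +
              ((if (openGraph (↑(γ₁ ∪ C₁) : BondConfig V)).Reachable s t ∧ (openGraph (↑(γ₂ ∪ C₂) : BondConfig V)).Reachable s t
                  then 1 else 0) +
                (if ((openGraph (↑(γ₁ ∪ C₁) : BondConfig V)).Reachable s t ∨
                      (openGraph (↑(γ₂ ∪ C₂) : BondConfig V)).Reachable s t) ∧
                    (openGraph (↑(γ₃ ∪ C₃) : BondConfig V)).Reachable s t then 1 else 0)) +
              ((if (openGraph (↑(M₁ \ γ₁ ∪ C₁) : BondConfig V)).Reachable s t ∧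
                    (openGraph (↑(M₂ \ γ₂ ∪ C₂) : BondConfig V)).Reachable s t then 1 else 0) +
                (if ((openGraph (↑(M₁ \ γ₁ ∪ C₁) : BondConfig V)).Reachable s t ∨
                      (openGraph (↑(M₂ \ γ₂ ∪ C₂) : BondConfig V)).Reachable s t) ∧
                    (openGraph (↑(M₃ \ γ₃ ∪ C₃) : BondConfig V)).Reachable s t then 1 else 0)) -
            4 * Fintype.card V) *
          ((f (γ₁ ∪ γ₂ ∪ γ₃ ∪ (C₁ ∪ C₂ ∪ C₃)) - f (M₁ \ γ₁ ∪ (M₂ \ γ₂) ∪ (M₃ \ γ₃) ∪ (C₁ ∪ C₂ ∪ C₃))) *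
            (g (γ₁ ∪ γ₂ ∪ γ₃ ∪ (C₁ ∪ C₂ ∪ C₃)) - g (M₁ \ γ₁ ∪ (M₂ \ γ₂) ∪ (M₃ \ γ₃) ∪ (C₁ ∪ C₂ ∪ C₃)))) := by
  have hd12M : Disjoint M₁ M₂ := Finset.disjoint_of_subset_left hM₁ (Finset.disjoint_of_subset_right hM₂ hd₁₂)
  have hd3M : Disjoint (M₁ ∪ M₂) M₃ :=
    Finset.disjoint_union_left.2 ⟨Finset.disjoint_of_subset_left hM₁ (Finset.disjoint_of_subset_right hM₃ hd₁₃),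
      Finset.disjoint_of_subset_left hM₂ (Finset.disjoint_of_subset_right hM₃ hd₂₃)⟩
  have key := sum_powerset_theta3 hd₁₂ hd₁₃ hd₂₃ h₁ h₂ h₃ h₁₂ h₁₃ h₂₃ hst hM₁ hM₂ hM₃ hC₁ hC₂ hC₃
    (fun n γ => w (n - 4 * Fintype.card V) *
      ((f (γ ∪ (C₁ ∪ C₂ ∪ C₃)) - f ((M₁ ∪ M₂ ∪ M₃) \ γ ∪ (C₁ ∪ C₂ ∪ C₃))) *
        (g (γ ∪ (C₁ ∪ C₂ ∪ C₃)) - g ((M₁ ∪ M₂ ∪ M₃) \ γ ∪ (C₁ ∪ C₂ ∪ C₃)))))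
  simp only [Nat.add_sub_cancel] at key
  rw [key]
  refine Finset.sum_congr rfl fun γ₁ hγ₁ => Finset.sum_congr rfl fun γ₂ hγ₂ => Finset.sum_congr rfl fun γ₃ hγ₃ => ?_
  rw [Finset.mem_powerset] at hγ₁ hγ₂ hγ₃
  rw [union_sdiff_union hd3M (Finset.union_subset_union hγ₁ hγ₂) hγ₃, union_sdiff_union hd12M hγ₁ hγ₂]

end Parallel3

end FK

end Summit.CriticalPhenomena.PercolationContinuityZ3.Theorems

end
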